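import Mathlib
import Literature.Analysis.Complex.CauchyPompeiu
import Literature.Analysis.Complex.CauchyTransform
import Literature.Analysis.Complex.CauchyTransformBounds
import HarnessLib

/-!
# The one-variable Cauchy transform of vector-valued densities supported in a disc

Elementary estimates for the Cauchy transform `(T g)(w) = ∫ (π t)⁻¹ • g (w - t) dA(t)`
(`Literature.Analysis.Complex.cauchyTransformAlong 1 g`) of a density `g : ℂ → F` with values in
a complex Banach space `F` and support in a disc `‖z‖ < ρ` — the vector-valued counterparts of
the scalar lemmas of `Literature/Analysis/Complex/ApproximateHolomorphy.lean`
(`Similarity.norm_cauchyTransform_le_of_forall_le`, `Similarity.differentiableOn_cauchyTransform_of_eq_zero`),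
written for the operator- and vector-valued similarity principle
(`Literature/Analysis/Complex/SimilarityIntegratingFactor.lean`,
`Literature/Analysis/Complex/SimilarityPrincipleVector.lean`):

* `SimilarityVector.norm_cauchyTransform_le_global` — `‖(T g)(w)‖ ≤ 2 (‖w‖ + ρ) G` everywhere,
  and `SimilarityVector.norm_cauchyTransform_le_of_norm_le` — `≤ 2 (ρ' + ρ) G` on `‖w‖ ≤ ρ'`,
  when `‖g‖ ≤ G` and `g` vanishes off `B(0, ρ)` (Hörmander (1973), proof of Thm 1.2.2: the
  kernel `(π t)⁻¹` is locally integrable, `∫_{|t|<R} |π t|⁻¹ dA = 2R`);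
* `SimilarityVector.cauchyTransform_sub`, `SimilarityVector.continuous_cauchyTransform` —
  linearity and continuity on continuous compactly supported densities;
* `SimilarityVector.differentiableOn_cauchyTransform_of_eq_zero` — `T g` is holomorphic on
  `B(c, ρ')` when the continuous compactly supported `g` vanishes on `B(c, ρₘ)`, `ρ' < ρₘ`
  (differentiation under the integral sign, Hörmander Thm 1.2.2).

Everything is proved; no definitions beyond abbreviations, no named facts.

## References

* L. Hörmander, *An introduction to complex analysis in several variables* (1973), Thm 1.2.2.
  [HormanderSCV1973]
-/

noncomputable section

open scoped ContDiff Topology Real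
open Set Metric MeasureTheory Filter Complex

namespace Literature.Analysis.Complex

namespace SimilarityVector

variable {F : Type*} [NormedAddCommGroup F] [NormedSpace ℂ F]

/-! ### Sup bounds -/

/-- **Global sup bound.** If `‖g‖ ≤ G` everywhere and `g` vanishes off `B(0, ρ)`, then
`‖(T g)(w)‖ ≤ 2 (‖w‖ + ρ) G` for every `w` (the density `t ↦ g (w - t)` lives in
`‖t‖ < ‖w‖ + ρ`). [cite: HormanderSCV1973, Thm. 1.2.2] -/
theorem norm_cauchyTransform_le_global {g : ℂ → F} {ρ G : ℝ} (hρ : 0 ≤ ρ) (hG : 0 ≤ G)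
    (hsupp : ∀ z, g z ≠ 0 → ‖z‖ < ρ) (hbound : ∀ z, ‖g z‖ ≤ G) (w : ℂ) :
    ‖cauchyTransformAlong 1 g w‖ ≤ 2 * (‖w‖ + ρ) * G := by
  refine norm_cauchyTransformAlong_le (by positivity) hG (fun t ht => ?_) (fun t => ?_)
  · rw [smul_eq_mul, mul_one] at ht
    have h1 := hsupp _ ht
    have h2 : ‖t‖ ≤ ‖w‖ + ‖w - t‖ := by
      have := norm_sub_le w (w - t)
      rwa [sub_sub_cancel] at this
    linarith
  · rw [smul_eq_mul, mul_one]
    exact hbound _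

/-- **Sup bound on a disc.** If `‖g‖ ≤ G` everywhere and `g` vanishes off `B(0, ρ)`, then
`‖(T g)(w)‖ ≤ 2 (ρ' + ρ) G` for `‖w‖ ≤ ρ'`. [cite: HormanderSCV1973, Thm. 1.2.2] -/
theorem norm_cauchyTransform_le_of_norm_le {g : ℂ → F} {ρ ρ' G : ℝ} (hρ : 0 ≤ ρ) (hG : 0 ≤ G)
    (hsupp : ∀ z, g z ≠ 0 → ‖z‖ < ρ) (hbound : ∀ z, ‖g z‖ ≤ G) {w : ℂ} (hw : ‖w‖ ≤ ρ') :
    ‖cauchyTransformAlong 1 g w‖ ≤ 2 * (ρ' + ρ) * G := by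
  calc ‖cauchyTransformAlong 1 g w‖ ≤ 2 * (‖w‖ + ρ) * G :=
        norm_cauchyTransform_le_global hρ hG hsupp hbound w
    _ ≤ 2 * (ρ' + ρ) * G := by gcongr

/-- **Sup bound on a disc from a bound on the support.** If `‖g z‖ ≤ G` for `‖z‖ < ρ` and `g`
vanishes off `B(0, ρ)`, then `‖(T g)(w)‖ ≤ 2 (ρ' + ρ) G` for `‖w‖ ≤ ρ'`. [folklore] -/
theorem norm_cauchyTransform_le_of_norm_le_on {g : ℂ → F} {ρ ρ' G : ℝ} (hρ : 0 ≤ ρ)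
    (hG : 0 ≤ G) (hsupp : ∀ z, g z ≠ 0 → ‖z‖ < ρ) (hbound : ∀ z, ‖z‖ < ρ → ‖g z‖ ≤ G)
    {w : ℂ} (hw : ‖w‖ ≤ ρ') :
    ‖cauchyTransformAlong 1 g w‖ ≤ 2 * (ρ' + ρ) * G := by
  refine norm_cauchyTransform_le_of_norm_le hρ hG hsupp (fun z => ?_) hw
  by_cases hz : ‖z‖ < ρ
  · exact hbound z hz
  · have h0 : g z = 0 := by
      by_contra h
      exact hz (hsupp z h)
    rw [h0, norm_zero]
    exact hG

/-! ### Linearity and continuity on continuous compactly supported densities -/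

/-- `T` is subtractive on continuous compactly supported densities. [folklore] -/
theorem cauchyTransform_sub {a b : ℂ → F} (ha : Continuous a) (hsa : HasCompactSupport a)
    (hb : Continuous b) (hsb : HasCompactSupport b) (w : ℂ) :
    cauchyTransformAlong 1 (a - b) w = cauchyTransformAlong 1 a w - cauchyTransformAlong 1 b w := by
  have hnb : Continuous (-b) := hb.neg
  have hsnb : HasCompactSupport (-b) := HasCompactSupport.neg hsb
  have h := cauchyTransformAlong_add ha hsa hnb hsnb (one_ne_zero (α := ℂ)) w
  have hneg : cauchyTransformAlong 1 (-b) w = -cauchyTransformAlong 1 b w := by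
    have h2 := cauchyTransformAlong_const_smul (-1 : ℂ) b 1 w
    rw [neg_one_smul, neg_one_smul] at h2
    exact h2
  rw [sub_eq_add_neg, h, hneg, sub_eq_add_neg]

/-- `T` applied to the negative. [folklore] -/
theorem cauchyTransform_neg (b : ℂ → F) (w : ℂ) :
    cauchyTransformAlong 1 (-b) w = -cauchyTransformAlong 1 b w := by
  have h2 := cauchyTransformAlong_const_smul (-1 : ℂ) b 1 w
  rw [neg_one_smul, neg_one_smul] at h2
  exact h2

/-- The Cauchy transform of a continuous compactly supported density is continuous. [folklore] -/
theorem continuous_cauchyTransform [CompleteSpace F] {g : ℂ → F} (hg : Continuous g)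
    (hsupp : HasCompactSupport g) : Continuous (cauchyTransformAlong 1 g) := by
  have h0 : ContDiff ℝ 0 g := contDiff_zero.2 hg
  exact contDiff_zero.1 (contDiff_cauchyTransformAlong h0 hsupp one_ne_zero)

/-- **Difference bound.** For continuous compactly supported `a`, `b` vanishing off `B(0, ρ)`
with `‖a z - b z‖ ≤ G` on `‖z‖ < ρ`: `‖T a w - T b w‖ ≤ 2 (ρ' + ρ) G` for `‖w‖ ≤ ρ'`. [folklore] -/
theorem norm_cauchyTransform_sub_le {a b : ℂ → F} (ha : Continuous a) (hsa : HasCompactSupport a)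
    (hb : Continuous b) (hsb : HasCompactSupport b) {ρ ρ' G : ℝ} (hρ : 0 ≤ ρ) (hG : 0 ≤ G)
    (hsuppa : ∀ z, a z ≠ 0 → ‖z‖ < ρ) (hsuppb : ∀ z, b z ≠ 0 → ‖z‖ < ρ)
    (hbound : ∀ z, ‖z‖ < ρ → ‖a z - b z‖ ≤ G) {w : ℂ} (hw : ‖w‖ ≤ ρ') :
    ‖cauchyTransformAlong 1 a w - cauchyTransformAlong 1 b w‖ ≤ 2 * (ρ' + ρ) * G := by
  rw [← cauchyTransform_sub ha hsa hb hsb]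
  refine norm_cauchyTransform_le_of_norm_le_on hρ hG (fun z hz => ?_) hbound hw
  by_contra hzρ
  have h1 : a z = 0 := by by_contra h; exact hzρ (hsuppa z h)
  have h2 : b z = 0 := by by_contra h; exact hzρ (hsuppb z h)
  exact hz (by simp [h1, h2])

/-- **Global difference bound.** Same, at an arbitrary point: `≤ 2 (‖w‖ + ρ) G`. [folklore] -/
theorem norm_cauchyTransform_sub_le_global {a b : ℂ → F} (ha : Continuous a)
    (hsa : HasCompactSupport a) (hb : Continuous b) (hsb : HasCompactSupport b) {ρ G : ℝ}
    (hρ : 0 ≤ ρ) (hG : 0 ≤ G) (hsuppa : ∀ z, a z ≠ 0 → ‖z‖ < ρ)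
    (hsuppb : ∀ z, b z ≠ 0 → ‖z‖ < ρ) (hbound : ∀ z, ‖z‖ < ρ → ‖a z - b z‖ ≤ G) (w : ℂ) :
    ‖cauchyTransformAlong 1 a w - cauchyTransformAlong 1 b w‖ ≤ 2 * (‖w‖ + ρ) * G :=
  norm_cauchyTransform_sub_le ha hsa hb hsb hρ hG hsuppa hsuppb hbound le_rfl

/-! ### Holomorphy off the support -/

/-- Change of variables `t = w - z` in the one-variable Cauchy transform:
`(T g)(w) = ∫ (π t)⁻¹ • g(w - t) dA(t) = -∫ (π (z - w))⁻¹ • g(z) dA(z)`. [folklore] -/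
theorem cauchyTransform_eq_neg_integral (g : ℂ → F) (w : ℂ) :
    cauchyTransformAlong 1 g w = -∫ z, ((↑π * (z - w))⁻¹ : ℂ) • g z := by
  have h1 : cauchyTransformAlong 1 g w = ∫ z, ((↑π * (w - z))⁻¹ : ℂ) • g z := by
    rw [cauchyTransformAlong_one_apply]
    have h := integral_sub_left_eq_self (fun z : ℂ => ((↑π * (w - z))⁻¹ : ℂ) • g z) volume w
    simp only [sub_sub_cancel] at h ⊢
    exact h
  rw [h1, ← integral_neg]
  congr 1
  funext z
  rw [← neg_sub z w, mul_neg, inv_neg, neg_smul]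

/-- **Holomorphy of `w ↦ ∫ (π (z - w))⁻¹ • g z` off the support** (vector-valued): if `g` is
integrable and vanishes on `B(c, ρ₁)`, then for `ρ₂ < ρ₁` this function is holomorphic on
`B(c, ρ₂)` (differentiate under the integral sign: the `w`-derivative `π⁻¹ (z - w)⁻²` of the
kernel is bounded by `π⁻¹ (ρ₁ - ρ₂)⁻²` on `supp g × B(c, ρ₂)`; Hörmander (1973), Thm 1.2.2).
[cite: HormanderSCV1973, Thm. 1.2.2] -/
theorem differentiableOn_integral_smul_cauchyKernel [CompleteSpace F] {g : ℂ → F}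
    (hg : Integrable g) {c : ℂ} {ρ₁ ρ₂ : ℝ} (hρ : ρ₂ < ρ₁) (hzero : ∀ z ∈ ball c ρ₁, g z = 0) :
    DifferentiableOn ℂ (fun w => ∫ z, ((↑π * (z - w))⁻¹ : ℂ) • g z) (ball c ρ₂) := by
  intro w₀ hw₀
  set d : ℝ := ρ₁ - ρ₂ with hd
  have hd0 : 0 < d := by rw [hd]; linarith
  -- distance from `supp g` to the small ball
  have hfar : ∀ z, g z ≠ 0 → ∀ w ∈ ball c ρ₂, d ≤ ‖z - w‖ := by
    intro z hz w hw
    have hz' : ρ₁ ≤ dist z c := by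
      by_contra h; exact hz (hzero z (mem_ball.2 (lt_of_not_ge h)))
    rw [mem_ball] at hw
    have := dist_triangle z w c
    simp only [dist_eq_norm] at this hw hz'
    linarith
  set G : ℂ → ℂ → F := fun w z => ((↑π * (z - w))⁻¹ : ℂ) • g z with hG
  set G' : ℂ → ℂ → F := fun w z => ((↑π)⁻¹ * ((z - w) ^ 2)⁻¹ : ℂ) • g z with hG'
  have hmeasK : ∀ w, AEStronglyMeasurable (G w) volume := fun w =>
    ((continuous_const.mul (continuous_id.sub continuous_const)).measurable.inv
      |>.aestronglyMeasurable).smul hg.aestronglyMeasurable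
  have hbound_ker : ∀ z, g z ≠ 0 → ∀ w ∈ ball c ρ₂, ‖((↑π * (z - w))⁻¹ : ℂ)‖ ≤ π⁻¹ * d⁻¹ := by
    intro z hz w hw
    have hzw := hfar z hz w hw
    have hzw0 : 0 < ‖z - w‖ := hd0.trans_le hzw
    rw [norm_inv, norm_mul, Complex.norm_real, Real.norm_eq_abs, abs_of_pos Real.pi_pos,
      mul_inv]
    exact mul_le_mul_of_nonneg_left (inv_anti₀ hd0 hzw) (by positivity)
  have hint : ∀ w ∈ ball c ρ₂, Integrable (G w) := by
    intro w hw
    refine Integrable.mono' (hg.norm.const_mul (π⁻¹ * d⁻¹)) (hmeasK w) (Eventually.of_forall ?_)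
    intro z
    simp only [hG, norm_smul]
    by_cases hz : g z = 0
    · simp [hz]
    · exact mul_le_mul_of_nonneg_right (hbound_ker z hz w hw) (norm_nonneg _)
  have hmeas' : AEStronglyMeasurable (G' w₀) volume := by
    refine (Measurable.aestronglyMeasurable ?_).smul hg.aestronglyMeasurable
    exact measurable_const.mul ((measurable_id.sub measurable_const).pow_const 2).inv
  have hbound : ∀ᵐ z ∂volume, ∀ w ∈ ball c ρ₂, ‖G' w z‖ ≤ (π⁻¹ * (d ^ 2)⁻¹) * ‖g z‖ := by
    refine Eventually.of_forall fun z w hw => ?_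
    simp only [hG', norm_smul, norm_mul, norm_inv, norm_pow, Complex.norm_real, Real.norm_eq_abs,
      abs_of_pos Real.pi_pos]
    by_cases hz : g z = 0
    · simp [hz]
    · have hzw := hfar z hz w hw
      refine mul_le_mul_of_nonneg_right ?_ (norm_nonneg _)
      refine mul_le_mul_of_nonneg_left ?_ (by positivity)
      exact inv_anti₀ (pow_pos hd0 2) (pow_le_pow_left₀ hd0.le hzw 2)
  have hdiff : ∀ᵐ z ∂volume, ∀ w ∈ ball c ρ₂, HasDerivAt (G · z) (G' w z) w := by
    refine Eventually.of_forall fun z w hw => ?_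
    by_cases hz : g z = 0
    · simp only [hG, hG', hz, smul_zero]; exact hasDerivAt_const w 0
    · have hzw : z - w ≠ 0 := by
        have := hfar z hz w hw; intro h0; rw [h0, norm_zero] at this; linarith
      have hπ : (π : ℂ) ≠ 0 := ofReal_ne_zero.2 Real.pi_pos.ne'
      have h1 : HasDerivAt (fun w : ℂ => (↑π * (z - w) : ℂ)) (↑π * (0 - 1)) w :=
        ((hasDerivAt_const w z).sub (hasDerivAt_id w)).const_mul _
      have h2 : HasDerivAt (fun w : ℂ => ((↑π * (z - w))⁻¹ : ℂ))
          (-(↑π * (0 - 1)) / (↑π * (z - w)) ^ 2) w := h1.inv (mul_ne_zero hπ hzw)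
      have h3 := h2.smul_const (g z)
      refine h3.congr_deriv ?_
      simp only [hG']
      congr 1
      field_simp
      ring
  have key := hasDerivAt_integral_of_dominated_loc_of_deriv_le (isOpen_ball.mem_nhds hw₀)
    (Eventually.of_forall hmeasK) (hint w₀ hw₀) hmeas' hbound (hg.norm.const_mul _) hdiff
  exact key.2.differentiableAt.differentiableWithinAt

/-- **Holomorphy of the Cauchy transform off the support of the density** (vector-valued). If
`g : ℂ → F` is continuous with compact support and vanishes on `B(c, ρₘ)`, then `T g` is
holomorphic on `B(c, ρ')` for every `ρ' < ρₘ`. [cite: HormanderSCV1973, Thm. 1.2.2] -/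
theorem differentiableOn_cauchyTransform_of_eq_zero [CompleteSpace F] {g : ℂ → F}
    (hg : Continuous g) (hgc : HasCompactSupport g) {c : ℂ} {ρ' ρm : ℝ} (h : ρ' < ρm)
    (hzero : ∀ z ∈ ball c ρm, g z = 0) :
    DifferentiableOn ℂ (cauchyTransformAlong 1 g) (ball c ρ') := by
  have hint : Integrable g := hg.integrable_of_hasCompactSupport hgc
  have key := (differentiableOn_integral_smul_cauchyKernel hint h hzero).neg
  have e : cauchyTransformAlong 1 g = fun w => -∫ z, ((↑π * (z - w))⁻¹ : ℂ) • g z :=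
    funext (cauchyTransform_eq_neg_integral g)
  rw [e]
  exact key

end SimilarityVector

end Literature.Analysis.Complex
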